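import Mathlib
import Literature.Analysis.UnboundedOperators.ConjugateOperatorRegularity
import HarnessLib
import Summits.AtomisticToContinuum.FouriersLaw.Theorems.EmbeddedDrudeMourreMourreDissolutionLAPDissipativeResolventDeriv

/-!
# Stub `stub_mourreThresholdLAP` — F2: a priori estimate, `‖G_ε‖ ≤ C/ε`, quadratic estimate

Item `stmt-AtomisticToContinuum-12594` (crux `MourreDissolution` of route `EmbeddedDrudeMourre`,
sub-problem `FouriersLaw`), line `separable-vertex-faddeev-pair-sector`, stub S6
`stub_mourreThresholdLAP` (Mourre's limiting absorption principle, `C²` form), helper F2 of the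
proof map (Mourre 1981; ABG = Amrein–Boutet de Monvel–Georgescu 1996, Lemma 7.3.2 eq. (7.3.3) and
Lemma 7.3.3 eqs. (7.3.4)–(7.3.5), smooth-cutoff form), over the dissipative resolvent family of
`…LAPDissipativeResolvent{,Identities,Deriv}` (notation `R(z) = resolventAt U z`,
`G = mourreG U M ε z = R(z) (1 + iε M R(z))⁻¹ = "(H - z + iεM)⁻¹"`, `Kinv = (1 + iε M R(z))⁻¹`,
`ε · Im z ≤ 0`).

The three estimates are proved for ABSTRACT data, so that the differential-inequality file can
instantiate them: a bounded "cutoff" `Φ` (in the application `Φ = φ(H)`, a plateau cutoff of the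
energy window), a bounded `M` (the Mourre commutator `φ(H)[H, iA]φ(H)`), a Mourre constant `a > 0`
with the MOURRE INEQUALITY `a ‖Φ f‖² ≤ Re ⟪f, M f⟫` (hypothesis), a localisation width `δ' > 0`
with the ENERGY LOCALISATION INEQUALITY `‖R(z) v‖² - ‖Φ R(z) v‖² ≤ δ'⁻² ‖v‖²` (hypothesis; it is
`norm_sq_resolventAt_sub_norm_sq_cutoff_le` of `…LAPEnergyLocalisation` for plateau cutoffs), and
the smallness condition `|ε| ‖M‖ ≤ δ'/2`.

* §0 two real-variable lemmas (solving `αX² ≤ βX + αQ²`, and `X² ≤ A + B² ⇒ X ≤ √A + B`);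
* §1 dissipativity: `M` is dissipative, the Mourre inequality for `M†`,
  `‖Kinv h‖ ≤ ‖h‖ + |ε| ‖M‖ ‖G h‖`, and the DISSIPATION INEQUALITY
  `|ε| Re ⟪G h, M G h⟫ + |Im z| ‖G h‖² ≤ ‖⟪h, G h⟫‖ ≤ ‖h‖ ‖G h‖`;
* §2 the A PRIORI ESTIMATE `(a/2) ‖G h‖² ≤ Re ⟪G h, M G h⟫ + (2a/δ'²) ‖h‖²` (ABG (7.3.3));
* §3 the NORM BOUND `‖G_ε(z)‖ ≤ 2/(a|ε|) + 2/δ' ≤ C/|ε|` (ABG (7.3.4));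
* §4 the QUADRATIC ESTIMATE `‖G h‖ ≤ (2/(a|ε|))^{1/2} ‖⟪h, G h⟫‖^{1/2} + (2/δ') ‖h‖` (ABG (7.3.5)),
  also for the adjoint `G†` (with `‖⟪h, G† h⟫‖ = ‖⟪h, G h⟫‖`), and §5 the headline
  `mourreG_quadratic_estimate`.
-/

noncomputable section

open MeasureTheory Complex Filter Topology Set
open scoped InnerProductSpace ComplexConjugate ENNReal NNReal

namespace Summit.AtomisticToContinuum.FouriersLaw.Theorems.MourreDissolution

open Literature.Analysis.UnboundedOperators
open Literature.Analysis.UnboundedOperators.UnitaryRep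

variable {H : Type*} [NormedAddCommGroup H] [InnerProductSpace ℂ H] [CompleteSpace H]

/-! ## §0. Two real-variable lemmas -/

/-- Solving the quadratic inequality `α X² ≤ β X + α Q²` (`α > 0`, `β, Q ≥ 0`):
`X ≤ β/α + Q`. [folklore] -/
theorem le_div_add_of_sq_le {α β Q X : ℝ} (hα : 0 < α) (hβ : 0 ≤ β) (hQ : 0 ≤ Q)
    (h : α * X ^ 2 ≤ β * X + α * Q ^ 2) : X ≤ β / α + Q := by
  rcases le_or_gt X Q with hXQ | hXQ
  · exact hXQ.trans (le_add_of_nonneg_left (div_nonneg hβ hα.le))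
  · have hX0 : 0 < X := hQ.trans_lt hXQ
    have h2 : α * Q ^ 2 ≤ α * Q * X := by nlinarith [mul_nonneg hα.le hQ]
    have h3 : (α * X) * X ≤ (β + α * Q) * X := by nlinarith
    have h4 : α * X ≤ β + α * Q := le_of_mul_le_mul_right h3 hX0
    rw [div_add' _ _ _ hα.ne', le_div_iff₀ hα]
    linarith

/-- `X² ≤ A + B²` with `A, B, X ≥ 0` gives `X ≤ √A + B`. [folklore] -/
theorem le_sqrt_add_of_sq_le {A B X : ℝ} (hA : 0 ≤ A) (hB : 0 ≤ B) (hX : 0 ≤ X)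
    (h : X ^ 2 ≤ A + B ^ 2) : X ≤ Real.sqrt A + B := by
  have hs : Real.sqrt A ^ 2 = A := Real.sq_sqrt hA
  have hs0 : 0 ≤ Real.sqrt A := Real.sqrt_nonneg A
  refine (sq_le_sq₀ hX (add_nonneg hs0 hB)).1 ?_
  nlinarith [mul_nonneg hs0 hB]

/-! ## §1. Dissipativity consequences of the Mourre inequality -/

omit [CompleteSpace H] in
/-- The Mourre inequality `a ‖Φ f‖² ≤ Re ⟪f, M f⟫` with `a ≥ 0` makes `M` dissipative:
`0 ≤ Re ⟪f, M f⟫`. [folklore] -/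
theorem re_inner_nonneg_of_mourre {Φ M : H →L[ℂ] H} {a : ℝ} (ha : 0 ≤ a)
    (hMourre : ∀ f : H, a * ‖Φ f‖ ^ 2 ≤ (⟪f, M f⟫_ℂ).re) (f : H) : 0 ≤ (⟪f, M f⟫_ℂ).re :=
  (mul_nonneg ha (sq_nonneg _)).trans (hMourre f)

/-- The Mourre inequality passes to the adjoint: `a ‖Φ f‖² ≤ Re ⟪f, M† f⟫ = Re ⟪f, M f⟫`.
[folklore] -/
theorem mourre_adjoint {Φ M : H →L[ℂ] H} {a : ℝ}
    (hMourre : ∀ f : H, a * ‖Φ f‖ ^ 2 ≤ (⟪f, M f⟫_ℂ).re) (f : H) :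
    a * ‖Φ f‖ ^ 2 ≤ (⟪f, ContinuousLinearMap.adjoint M f⟫_ℂ).re := by
  rw [ContinuousLinearMap.adjoint_inner_right, ← RCLike.re_to_complex, inner_re_symm,
    RCLike.re_to_complex]
  exact hMourre f

/-- `‖Kinv h‖ ≤ ‖h‖ + |ε| ‖M‖ ‖G h‖` (`Kinv h = h - iε M (G h)`).
[cite: AmreinBoutetdeMonvelGeorgescu1996, Lemma 7.3.3] -/
theorem norm_mourreKinv_apply_le {M : H →L[ℂ] H} (hM : ∀ f : H, 0 ≤ (⟪f, M f⟫_ℂ).re)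
    {z : ℂ} (hz : z.im ≠ 0) {ε : ℝ} (hεz : ε * z.im ≤ 0) (U : OneParameterUnitaryGroup H) (h : H) :
    ‖mourreKinv U M ε z h‖ ≤ ‖h‖ + |ε| * ‖M‖ * ‖mourreG U M ε z h‖ := by
  rw [mourreKinv_apply hM hz hεz U h]
  refine (norm_sub_le _ _).trans ?_
  rw [norm_smul, norm_mul, Complex.norm_I, one_mul, Complex.norm_real, Real.norm_eq_abs, mul_assoc]
  gcongr
  exact M.le_opNorm _

/-- **Dissipation inequality**: `|ε| Re ⟪G h, M G h⟫ + |Im z| ‖G h‖² ≤ ‖⟪h, G h⟫‖` — the two terms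
of `Im ⟪h, G h⟫ = Im z ‖G h‖² - ε Re ⟪G h, M G h⟫` (`im_inner_mourreG`) have the same sign when
`ε · Im z ≤ 0` and `Re ⟪g, M g⟫ ≥ 0`. [cite: AmreinBoutetdeMonvelGeorgescu1996, Lemma 7.3.3] -/
theorem dissipation_le_norm_inner_mourreG {M : H →L[ℂ] H} (hM : ∀ f : H, 0 ≤ (⟪f, M f⟫_ℂ).re)
    {z : ℂ} (hz : z.im ≠ 0) {ε : ℝ} (hεz : ε * z.im ≤ 0) (U : OneParameterUnitaryGroup H) (h : H) :
    |ε| * (⟪mourreG U M ε z h, M (mourreG U M ε z h)⟫_ℂ).re + |z.im| * ‖mourreG U M ε z h‖ ^ 2 ≤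
      ‖⟪h, mourreG U M ε z h⟫_ℂ‖ := by
  have hid := im_inner_mourreG hM hz hεz U h
  set g := mourreG U M ε z h with hg
  have hre : 0 ≤ (⟪g, M g⟫_ℂ).re := hM g
  refine le_trans ?_ (Complex.abs_im_le_norm _)
  rw [hid]
  rcases lt_or_gt_of_ne hz with hneg | hpos
  · have hε : 0 ≤ ε := by
      by_contra hcon
      exact absurd hεz (not_le.2 (mul_pos_of_neg_of_neg (not_le.1 hcon) hneg))
    have h1 : z.im * ‖g‖ ^ 2 ≤ 0 := mul_nonpos_of_nonpos_of_nonneg hneg.le (sq_nonneg _)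
    have h2 : 0 ≤ ε * (⟪g, M g⟫_ℂ).re := mul_nonneg hε hre
    rw [abs_of_nonneg hε, abs_of_neg hneg, abs_of_nonpos (by linarith)]
    linarith
  · have hε : ε ≤ 0 := by
      by_contra hcon
      exact absurd hεz (not_le.2 (mul_pos (not_le.1 hcon) hpos))
    have h1 : 0 ≤ z.im * ‖g‖ ^ 2 := mul_nonneg hpos.le (sq_nonneg _)
    have h2 : ε * (⟪g, M g⟫_ℂ).re ≤ 0 := mul_nonpos_of_nonpos_of_nonneg hε hre
    rw [abs_of_nonpos hε, abs_of_pos hpos, abs_of_nonneg (by linarith)]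
    linarith

/-! ## §2. The a priori estimate (ABG (7.3.3), smooth cutoff) -/

/-- **A priori estimate** (ABG Lemma 7.3.2 / eq. (7.3.3) with a smooth energy cutoff): under the
Mourre inequality `a ‖Φ f‖² ≤ Re ⟪f, M f⟫`, the localisation inequality
`‖R(z) v‖² - ‖Φ R(z) v‖² ≤ δ'⁻² ‖v‖²` and `|ε| ‖M‖ ≤ δ'/2`, for every `h`, with `g = G_ε(z) h`:
`(a/2) ‖g‖² ≤ Re ⟪g, M g⟫ + (2a/δ'²) ‖h‖²`.
Proof: `a ‖Φ g‖² ≤ Re ⟪g, M g⟫`; `g = R(z) v` with `v = Kinv h = h - iε M g`, so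
`a (‖g‖² - ‖Φ g‖²) ≤ a δ'⁻² ‖v‖² ≤ 2a δ'⁻² (‖h‖² + ε² ‖M‖² ‖g‖²) ≤ 2a δ'⁻² ‖h‖² + (a/2) ‖g‖²`.
[cite: AmreinBoutetdeMonvelGeorgescu1996, Lemma 7.3.3 eq. (7.3.4)] -/
theorem apriori_mourreG (U : OneParameterUnitaryGroup H) {Φ M : H →L[ℂ] H} {a δ' : ℝ} {z : ℂ}
    {ε : ℝ} (ha : 0 < a) (hMourre : ∀ f : H, a * ‖Φ f‖ ^ 2 ≤ (⟪f, M f⟫_ℂ).re) (hδ : 0 < δ')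
    (hz : z.im ≠ 0) (hεz : ε * z.im ≤ 0)
    (hloc : ∀ v : H,
      ‖resolventAt U z v‖ ^ 2 - ‖Φ (resolventAt U z v)‖ ^ 2 ≤ δ'⁻¹ ^ 2 * ‖v‖ ^ 2)
    (hε : |ε| * ‖M‖ ≤ δ' / 2) (h : H) :
    a / 2 * ‖mourreG U M ε z h‖ ^ 2 ≤
      (⟪mourreG U M ε z h, M (mourreG U M ε z h)⟫_ℂ).re + 2 * a * δ'⁻¹ ^ 2 * ‖h‖ ^ 2 := by
  have hM : ∀ f : H, 0 ≤ (⟪f, M f⟫_ℂ).re := re_inner_nonneg_of_mourre ha.le hMourre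
  have hK := norm_mourreKinv_apply_le hM hz hεz U h
  set g := mourreG U M ε z h with hg
  set v := mourreKinv U M ε z h with hv
  have h1 : a * ‖Φ g‖ ^ 2 ≤ (⟪g, M g⟫_ℂ).re := hMourre g
  have h2 : ‖g‖ ^ 2 - ‖Φ g‖ ^ 2 ≤ δ'⁻¹ ^ 2 * ‖v‖ ^ 2 := hloc v
  have h3 : ‖v‖ ^ 2 ≤ 2 * ‖h‖ ^ 2 + 2 * ((|ε| * ‖M‖) ^ 2 * ‖g‖ ^ 2) := by
    have h0 : 0 ≤ |ε| * ‖M‖ * ‖g‖ := by positivity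
    nlinarith [hK, norm_nonneg v, norm_nonneg h, sq_nonneg (‖h‖ - |ε| * ‖M‖ * ‖g‖)]
  have hst : δ'⁻¹ ^ 2 * (|ε| * ‖M‖) ^ 2 ≤ 1 / 4 := by
    have hεM : 0 ≤ |ε| * ‖M‖ := by positivity
    calc δ'⁻¹ ^ 2 * (|ε| * ‖M‖) ^ 2 ≤ δ'⁻¹ ^ 2 * (δ' / 2) ^ 2 := by gcongr
      _ = 1 / 4 := by field_simp; ring
  have h4 : a * (‖g‖ ^ 2 - ‖Φ g‖ ^ 2) ≤
      2 * a * δ'⁻¹ ^ 2 * ‖h‖ ^ 2 + 2 * a * (δ'⁻¹ ^ 2 * (|ε| * ‖M‖) ^ 2) * ‖g‖ ^ 2 :=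
    calc a * (‖g‖ ^ 2 - ‖Φ g‖ ^ 2)
        ≤ a * (δ'⁻¹ ^ 2 * (2 * ‖h‖ ^ 2 + 2 * ((|ε| * ‖M‖) ^ 2 * ‖g‖ ^ 2))) :=
          mul_le_mul_of_nonneg_left (h2.trans (mul_le_mul_of_nonneg_left h3 (sq_nonneg _))) ha.le
      _ = _ := by ring
  have h5 : 2 * a * (δ'⁻¹ ^ 2 * (|ε| * ‖M‖) ^ 2) * ‖g‖ ^ 2 ≤ 2 * a * (1 / 4) * ‖g‖ ^ 2 := by
    gcongr
  linarith [h1, h4, h5]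

/-- **A priori estimate combined with dissipation**: multiplying the a priori estimate by `|ε|` and
adding `|Im z| ‖G h‖²`, the dissipation inequality turns `|ε| Re ⟪G h, M G h⟫ + |Im z| ‖G h‖²` into
`‖⟪h, G h⟫‖`: `(a|ε|/2 + |Im z|) ‖G h‖² ≤ ‖⟪h, G h⟫‖ + (2a/δ'²) |ε| ‖h‖²`.
[cite: AmreinBoutetdeMonvelGeorgescu1996, Lemma 7.3.3 eq. (7.3.4)] -/
theorem apriori_dissipation_mourreG (U : OneParameterUnitaryGroup H) {Φ M : H →L[ℂ] H}
    {a δ' : ℝ} {z : ℂ} {ε : ℝ} (ha : 0 < a)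
    (hMourre : ∀ f : H, a * ‖Φ f‖ ^ 2 ≤ (⟪f, M f⟫_ℂ).re) (hδ : 0 < δ') (hz : z.im ≠ 0)
    (hεz : ε * z.im ≤ 0)
    (hloc : ∀ v : H,
      ‖resolventAt U z v‖ ^ 2 - ‖Φ (resolventAt U z v)‖ ^ 2 ≤ δ'⁻¹ ^ 2 * ‖v‖ ^ 2)
    (hε : |ε| * ‖M‖ ≤ δ' / 2) (h : H) :
    a / 2 * |ε| * ‖mourreG U M ε z h‖ ^ 2 + |z.im| * ‖mourreG U M ε z h‖ ^ 2 ≤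
      ‖⟪h, mourreG U M ε z h⟫_ℂ‖ + 2 * a * δ'⁻¹ ^ 2 * |ε| * ‖h‖ ^ 2 := by
  have hM : ∀ f : H, 0 ≤ (⟪f, M f⟫_ℂ).re := re_inner_nonneg_of_mourre ha.le hMourre
  have h1 := apriori_mourreG U ha hMourre hδ hz hεz hloc hε h
  have h2 := dissipation_le_norm_inner_mourreG hM hz hεz U h
  have h3 := mul_le_mul_of_nonneg_left h1 (abs_nonneg ε)
  nlinarith [h2, h3]

/-! ## §3. The norm bound `‖G_ε(z)‖ ≤ C/|ε|` (ABG (7.3.4)) -/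

/-- **Norm bound, vector form**: `‖G h‖ ≤ (2/(a|ε|) + 2/δ') ‖h‖` for `ε ≠ 0` (solve the quadratic
inequality `(a|ε|/2) X² ≤ ‖h‖ X + (2a/δ'²)|ε| ‖h‖²`, `X = ‖G h‖`, obtained from
`apriori_dissipation_mourreG` and `‖⟪h, G h⟫‖ ≤ ‖h‖ X`).
[cite: AmreinBoutetdeMonvelGeorgescu1996, Lemma 7.3.3 eq. (7.3.4)] -/
theorem norm_mourreG_apply_le_of_mourre (U : OneParameterUnitaryGroup H) {Φ M : H →L[ℂ] H}
    {a δ' : ℝ} {z : ℂ} {ε : ℝ} (ha : 0 < a)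
    (hMourre : ∀ f : H, a * ‖Φ f‖ ^ 2 ≤ (⟪f, M f⟫_ℂ).re) (hδ : 0 < δ') (hz : z.im ≠ 0)
    (hεz : ε * z.im ≤ 0)
    (hloc : ∀ v : H,
      ‖resolventAt U z v‖ ^ 2 - ‖Φ (resolventAt U z v)‖ ^ 2 ≤ δ'⁻¹ ^ 2 * ‖v‖ ^ 2)
    (hε : |ε| * ‖M‖ ≤ δ' / 2) (hε0 : ε ≠ 0) (h : H) :
    ‖mourreG U M ε z h‖ ≤ (2 * (a * |ε|)⁻¹ + 2 * δ'⁻¹) * ‖h‖ := by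
  have h1 := apriori_dissipation_mourreG U ha hMourre hδ hz hεz hloc hε h
  set g := mourreG U M ε z h with hg
  have hεpos : 0 < |ε| := abs_pos.2 hε0
  have hα : 0 < a / 2 * |ε| := by positivity
  have h3 : 0 ≤ |z.im| * ‖g‖ ^ 2 := by positivity
  have hq : a / 2 * |ε| * ‖g‖ ^ 2 ≤ ‖h‖ * ‖g‖ + a / 2 * |ε| * (2 * δ'⁻¹ * ‖h‖) ^ 2 :=
    calc a / 2 * |ε| * ‖g‖ ^ 2
        ≤ ‖⟪h, g⟫_ℂ‖ + 2 * a * δ'⁻¹ ^ 2 * |ε| * ‖h‖ ^ 2 - |z.im| * ‖g‖ ^ 2 := by linarith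
      _ ≤ ‖h‖ * ‖g‖ + 2 * a * δ'⁻¹ ^ 2 * |ε| * ‖h‖ ^ 2 := by
          linarith [norm_inner_le_norm (𝕜 := ℂ) h g]
      _ = ‖h‖ * ‖g‖ + a / 2 * |ε| * (2 * δ'⁻¹ * ‖h‖) ^ 2 := by ring
  have h4 := le_div_add_of_sq_le hα (norm_nonneg h) (by positivity) hq
  calc ‖g‖ ≤ ‖h‖ / (a / 2 * |ε|) + 2 * δ'⁻¹ * ‖h‖ := h4
    _ = (2 * (a * |ε|)⁻¹ + 2 * δ'⁻¹) * ‖h‖ := by field_simp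

/-- **Norm bound `‖G_ε(z)‖ ≤ 2/(a|ε|) + 2/δ'`** for `ε ≠ 0`, uniformly in `z` (given the
localisation inequality at `z`).
[cite: AmreinBoutetdeMonvelGeorgescu1996, Lemma 7.3.3 eq. (7.3.4)] -/
theorem norm_mourreG_le_of_mourre (U : OneParameterUnitaryGroup H) {Φ M : H →L[ℂ] H}
    {a δ' : ℝ} {z : ℂ} {ε : ℝ} (ha : 0 < a)
    (hMourre : ∀ f : H, a * ‖Φ f‖ ^ 2 ≤ (⟪f, M f⟫_ℂ).re) (hδ : 0 < δ') (hz : z.im ≠ 0)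
    (hεz : ε * z.im ≤ 0)
    (hloc : ∀ v : H,
      ‖resolventAt U z v‖ ^ 2 - ‖Φ (resolventAt U z v)‖ ^ 2 ≤ δ'⁻¹ ^ 2 * ‖v‖ ^ 2)
    (hε : |ε| * ‖M‖ ≤ δ' / 2) (hε0 : ε ≠ 0) :
    ‖mourreG U M ε z‖ ≤ 2 * (a * |ε|)⁻¹ + 2 * δ'⁻¹ :=
  ContinuousLinearMap.opNorm_le_bound _ (by positivity) fun h =>
    norm_mourreG_apply_le_of_mourre U ha hMourre hδ hz hεz hloc hε hε0 h

/-- **Norm bound in the form `‖G_ε(z)‖ ≤ C/|ε|`**: for `0 < |ε| ≤ ε₁`,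
`‖G_ε(z)‖ ≤ (2/a + 2ε₁/δ') / |ε|`, with a constant depending only on `a, δ', ε₁`.
[cite: AmreinBoutetdeMonvelGeorgescu1996, Lemma 7.3.3 eq. (7.3.4)] -/
theorem norm_mourreG_le_div_abs (U : OneParameterUnitaryGroup H) {Φ M : H →L[ℂ] H}
    {a δ' : ℝ} {z : ℂ} {ε : ℝ} (ha : 0 < a)
    (hMourre : ∀ f : H, a * ‖Φ f‖ ^ 2 ≤ (⟪f, M f⟫_ℂ).re) (hδ : 0 < δ') (hz : z.im ≠ 0)
    (hεz : ε * z.im ≤ 0)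
    (hloc : ∀ v : H,
      ‖resolventAt U z v‖ ^ 2 - ‖Φ (resolventAt U z v)‖ ^ 2 ≤ δ'⁻¹ ^ 2 * ‖v‖ ^ 2)
    (hε : |ε| * ‖M‖ ≤ δ' / 2) (hε0 : ε ≠ 0) {ε₁ : ℝ} (hε₁ : |ε| ≤ ε₁) :
    ‖mourreG U M ε z‖ ≤ (2 * a⁻¹ + 2 * δ'⁻¹ * ε₁) * |ε|⁻¹ := by
  have hεpos : 0 < |ε| := abs_pos.2 hε0
  have hεne : |ε| ≠ 0 := hεpos.ne'
  have hane : a ≠ 0 := ha.ne'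
  have hδne : δ' ≠ 0 := hδ.ne'
  calc ‖mourreG U M ε z‖ ≤ 2 * (a * |ε|)⁻¹ + 2 * δ'⁻¹ :=
        norm_mourreG_le_of_mourre U ha hMourre hδ hz hεz hloc hε hε0
    _ = (2 * a⁻¹ + 2 * δ'⁻¹ * |ε|) * |ε|⁻¹ := by
        field_simp
    _ ≤ (2 * a⁻¹ + 2 * δ'⁻¹ * ε₁) * |ε|⁻¹ := by gcongr

/-- The adjoint has the same norm: `‖G_ε(z)†‖ ≤ 2/(a|ε|) + 2/δ'`.
[cite: AmreinBoutetdeMonvelGeorgescu1996, Lemma 7.3.3 eq. (7.3.4)] -/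
theorem norm_adjoint_mourreG_le_of_mourre (U : OneParameterUnitaryGroup H) {Φ M : H →L[ℂ] H}
    {a δ' : ℝ} {z : ℂ} {ε : ℝ} (ha : 0 < a)
    (hMourre : ∀ f : H, a * ‖Φ f‖ ^ 2 ≤ (⟪f, M f⟫_ℂ).re) (hδ : 0 < δ') (hz : z.im ≠ 0)
    (hεz : ε * z.im ≤ 0)
    (hloc : ∀ v : H,
      ‖resolventAt U z v‖ ^ 2 - ‖Φ (resolventAt U z v)‖ ^ 2 ≤ δ'⁻¹ ^ 2 * ‖v‖ ^ 2)
    (hε : |ε| * ‖M‖ ≤ δ' / 2) (hε0 : ε ≠ 0) :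
    ‖ContinuousLinearMap.adjoint (mourreG U M ε z)‖ ≤ 2 * (a * |ε|)⁻¹ + 2 * δ'⁻¹ := by
  rw [LinearIsometryEquiv.norm_map]
  exact norm_mourreG_le_of_mourre U ha hMourre hδ hz hεz hloc hε hε0

/-! ## §4. The quadratic estimate (ABG (7.3.5)) -/

/-- **Quadratic estimate, squared form**: for `ε ≠ 0`,
`‖G h‖² ≤ (2/(a|ε|)) ‖⟪h, G h⟫‖ + (2 ‖h‖/δ')²`.
[cite: AmreinBoutetdeMonvelGeorgescu1996, Lemma 7.3.3 eq. (7.3.5)] -/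
theorem norm_sq_mourreG_apply_le_quadratic (U : OneParameterUnitaryGroup H) {Φ M : H →L[ℂ] H}
    {a δ' : ℝ} {z : ℂ} {ε : ℝ} (ha : 0 < a)
    (hMourre : ∀ f : H, a * ‖Φ f‖ ^ 2 ≤ (⟪f, M f⟫_ℂ).re) (hδ : 0 < δ') (hz : z.im ≠ 0)
    (hεz : ε * z.im ≤ 0)
    (hloc : ∀ v : H,
      ‖resolventAt U z v‖ ^ 2 - ‖Φ (resolventAt U z v)‖ ^ 2 ≤ δ'⁻¹ ^ 2 * ‖v‖ ^ 2)
    (hε : |ε| * ‖M‖ ≤ δ' / 2) (hε0 : ε ≠ 0) (h : H) :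
    ‖mourreG U M ε z h‖ ^ 2 ≤
      2 * (a * |ε|)⁻¹ * ‖⟪h, mourreG U M ε z h⟫_ℂ‖ + (2 * δ'⁻¹ * ‖h‖) ^ 2 := by
  have h1 := apriori_dissipation_mourreG U ha hMourre hδ hz hεz hloc hε h
  set g := mourreG U M ε z h with hg
  have hεpos : 0 < |ε| := abs_pos.2 hε0
  have hεne : |ε| ≠ 0 := hεpos.ne'
  have hane : a ≠ 0 := ha.ne'
  have hδne : δ' ≠ 0 := hδ.ne'
  have hα : 0 < a / 2 * |ε| := by positivity
  have h3 : 0 ≤ |z.im| * ‖g‖ ^ 2 := by positivity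
  have h4 : a / 2 * |ε| * ‖g‖ ^ 2 ≤ ‖⟪h, g⟫_ℂ‖ + 2 * a * δ'⁻¹ ^ 2 * |ε| * ‖h‖ ^ 2 := by linarith
  rw [← le_div_iff₀' hα] at h4
  calc ‖g‖ ^ 2 ≤ (‖⟪h, g⟫_ℂ‖ + 2 * a * δ'⁻¹ ^ 2 * |ε| * ‖h‖ ^ 2) / (a / 2 * |ε|) := h4
    _ = 2 * (a * |ε|)⁻¹ * ‖⟪h, g⟫_ℂ‖ + (2 * δ'⁻¹ * ‖h‖) ^ 2 := by field_simp

/-- **Quadratic estimate** (ABG (7.3.5)): for `ε ≠ 0` and every `h`,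
`‖G_ε(z) h‖ ≤ (2/(a|ε|))^{1/2} ‖⟪h, G_ε(z) h⟫‖^{1/2} + (2/δ') ‖h‖`.
[cite: AmreinBoutetdeMonvelGeorgescu1996, Lemma 7.3.3 eq. (7.3.5)] -/
theorem norm_mourreG_apply_le_sqrt (U : OneParameterUnitaryGroup H) {Φ M : H →L[ℂ] H}
    {a δ' : ℝ} {z : ℂ} {ε : ℝ} (ha : 0 < a)
    (hMourre : ∀ f : H, a * ‖Φ f‖ ^ 2 ≤ (⟪f, M f⟫_ℂ).re) (hδ : 0 < δ') (hz : z.im ≠ 0)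
    (hεz : ε * z.im ≤ 0)
    (hloc : ∀ v : H,
      ‖resolventAt U z v‖ ^ 2 - ‖Φ (resolventAt U z v)‖ ^ 2 ≤ δ'⁻¹ ^ 2 * ‖v‖ ^ 2)
    (hε : |ε| * ‖M‖ ≤ δ' / 2) (hε0 : ε ≠ 0) (h : H) :
    ‖mourreG U M ε z h‖ ≤
      Real.sqrt (2 * (a * |ε|)⁻¹) * Real.sqrt ‖⟪h, mourreG U M ε z h⟫_ℂ‖ + 2 * δ'⁻¹ * ‖h‖ := by
  have h1 := norm_sq_mourreG_apply_le_quadratic U ha hMourre hδ hz hεz hloc hε hε0 h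
  have hx : 0 ≤ 2 * (a * |ε|)⁻¹ := by positivity
  rw [← Real.sqrt_mul hx]
  exact le_sqrt_add_of_sq_le (by positivity) (by positivity) (norm_nonneg _) h1

/-- `‖⟪h, T† h⟫‖ = ‖⟪h, T h⟫‖` (`⟪h, T† h⟫ = conj ⟪h, T h⟫`). [folklore] -/
theorem norm_inner_adjoint_apply_self (T : H →L[ℂ] H) (h : H) :
    ‖⟪h, ContinuousLinearMap.adjoint T h⟫_ℂ‖ = ‖⟪h, T h⟫_ℂ‖ := by
  rw [ContinuousLinearMap.adjoint_inner_right, ← inner_conj_symm, Complex.norm_conj]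

/-- **Quadratic estimate for the adjoint**: `G_ε(z)† = G_{-ε}(z̄)` built on `M†`
(`adjoint_mourreG`), the mirrored data satisfy the same hypotheses (`M†` obeys the Mourre
inequality, `|-ε| = |ε|`, `‖M†‖ = ‖M‖`), so — given the localisation inequality at `z̄` — for
`ε ≠ 0` and every `h`:
`‖G_ε(z)† h‖ ≤ (2/(a|ε|))^{1/2} ‖⟪h, G_ε(z) h⟫‖^{1/2} + (2/δ') ‖h‖`
(note `‖⟪h, G† h⟫‖ = ‖⟪h, G h⟫‖`).
[cite: AmreinBoutetdeMonvelGeorgescu1996, Lemma 7.3.3 eq. (7.3.5)] -/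
theorem norm_adjoint_mourreG_apply_le_sqrt (U : OneParameterUnitaryGroup H) {Φ M : H →L[ℂ] H}
    {a δ' : ℝ} {z : ℂ} {ε : ℝ} (ha : 0 < a)
    (hMourre : ∀ f : H, a * ‖Φ f‖ ^ 2 ≤ (⟪f, M f⟫_ℂ).re) (hδ : 0 < δ') (hz : z.im ≠ 0)
    (hεz : ε * z.im ≤ 0)
    (hloc' : ∀ v : H,
      ‖resolventAt U (conj z) v‖ ^ 2 - ‖Φ (resolventAt U (conj z) v)‖ ^ 2 ≤ δ'⁻¹ ^ 2 * ‖v‖ ^ 2)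
    (hε : |ε| * ‖M‖ ≤ δ' / 2) (hε0 : ε ≠ 0) (h : H) :
    ‖ContinuousLinearMap.adjoint (mourreG U M ε z) h‖ ≤
      Real.sqrt (2 * (a * |ε|)⁻¹) * Real.sqrt ‖⟪h, mourreG U M ε z h⟫_ℂ‖ + 2 * δ'⁻¹ * ‖h‖ := by
  have hM : ∀ f : H, 0 ≤ (⟪f, M f⟫_ℂ).re := re_inner_nonneg_of_mourre ha.le hMourre
  have hz' : (conj z).im ≠ 0 := by rw [Complex.conj_im]; exact neg_ne_zero.2 hz
  have hεz' : -ε * (conj z).im ≤ 0 := by rw [neg_mul_conj_im]; exact hεz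
  have hε' : |(-ε)| * ‖ContinuousLinearMap.adjoint M‖ ≤ δ' / 2 := by
    rwa [abs_neg, LinearIsometryEquiv.norm_map]
  have key := norm_mourreG_apply_le_sqrt U ha (mourre_adjoint hMourre) hδ hz' hεz' hloc' hε'
    (neg_ne_zero.2 hε0) h
  rw [← adjoint_mourreG hM hz hεz U, norm_inner_adjoint_apply_self, abs_neg] at key
  exact key

/-! ## §5. Headline (registered helper stub) -/

/-- **A priori estimate, norm bound and quadratic estimate for Mourre's dissipative resolvent,
headline form** (all binders explicit; registered helper stub of `stub_mourreThresholdLAP`,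
S6-PLAN F2): for a one-parameter unitary group `U(t) = e^{itH}` with resolvent
`R(z) = resolventAt U z`, bounded `Φ, M`, constants `a, δ' > 0`, a real `ε` and a non-real `z` with
`ε · Im z ≤ 0`, under the MOURRE INEQUALITY `a ‖Φ f‖² ≤ Re ⟪f, M f⟫`, the LOCALISATION INEQUALITY
`‖R(z) v‖² - ‖Φ R(z) v‖² ≤ δ'⁻² ‖v‖²` and `|ε| ‖M‖ ≤ δ'/2`, Mourre's resolvent
`G = mourreG U M ε z = R(z)(1 + iε M R(z))⁻¹` satisfies
(1) `(a/2) ‖G h‖² ≤ Re ⟪G h, M G h⟫ + (2a/δ'²) ‖h‖²` for all `h`;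
(2) `‖G‖ ≤ 2/(a|ε|) + 2/δ'` if `ε ≠ 0`;
(3) `‖G h‖ ≤ (2/(a|ε|))^{1/2} ‖⟪h, G h⟫‖^{1/2} + (2/δ') ‖h‖` if `ε ≠ 0`;
(4) the same bound for `‖G† h‖`, given in addition the localisation inequality at `z̄`.
[cite: AmreinBoutetdeMonvelGeorgescu1996, Lemma 7.3.3 eqs. (7.3.4)–(7.3.5)] -/
theorem mourreG_quadratic_estimate :
    ∀ (K : Type) [NormedAddCommGroup K] [InnerProductSpace ℂ K] [CompleteSpace K]
      (U : Literature.Analysis.UnboundedOperators.OneParameterUnitaryGroup K) (Φ M : K →L[ℂ] K)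
      (a δ' ε : ℝ) (z : ℂ), 0 < a → (∀ f : K, a * ‖Φ f‖ ^ 2 ≤ (inner ℂ f (M f)).re) → 0 < δ' →
        z.im ≠ 0 → ε * z.im ≤ 0 →
        (∀ v : K,
          ‖Summit.AtomisticToContinuum.FouriersLaw.Theorems.MourreDissolution.resolventAt U z v‖ ^ 2 -
              ‖Φ (Summit.AtomisticToContinuum.FouriersLaw.Theorems.MourreDissolution.resolventAt U z v)‖ ^ 2 ≤
            δ'⁻¹ ^ 2 * ‖v‖ ^ 2) →
        |ε| * ‖M‖ ≤ δ' / 2 →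
        (∀ h : K,
          a / 2 * ‖Summit.AtomisticToContinuum.FouriersLaw.Theorems.MourreDissolution.mourreG U M ε z h‖ ^ 2 ≤
            (inner ℂ (Summit.AtomisticToContinuum.FouriersLaw.Theorems.MourreDissolution.mourreG U M ε z h)
                (M (Summit.AtomisticToContinuum.FouriersLaw.Theorems.MourreDissolution.mourreG U M ε z h))).re +
              2 * a * δ'⁻¹ ^ 2 * ‖h‖ ^ 2) ∧
        (ε ≠ 0 →
          ‖Summit.AtomisticToContinuum.FouriersLaw.Theorems.MourreDissolution.mourreG U M ε z‖ ≤
            2 * (a * |ε|)⁻¹ + 2 * δ'⁻¹) ∧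
        (ε ≠ 0 → ∀ h : K,
          ‖Summit.AtomisticToContinuum.FouriersLaw.Theorems.MourreDissolution.mourreG U M ε z h‖ ≤
            Real.sqrt (2 * (a * |ε|)⁻¹) *
                Real.sqrt ‖inner ℂ h
                  (Summit.AtomisticToContinuum.FouriersLaw.Theorems.MourreDissolution.mourreG U M ε z h)‖ +
              2 * δ'⁻¹ * ‖h‖) ∧
        (ε ≠ 0 →
          (∀ v : K,
            ‖Summit.AtomisticToContinuum.FouriersLaw.Theorems.MourreDissolution.resolventAt U
                  (starRingEnd ℂ z) v‖ ^ 2 -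
                ‖Φ (Summit.AtomisticToContinuum.FouriersLaw.Theorems.MourreDissolution.resolventAt U
                  (starRingEnd ℂ z) v)‖ ^ 2 ≤
              δ'⁻¹ ^ 2 * ‖v‖ ^ 2) →
          ∀ h : K,
            ‖ContinuousLinearMap.adjoint
                  (Summit.AtomisticToContinuum.FouriersLaw.Theorems.MourreDissolution.mourreG U M ε z) h‖ ≤
              Real.sqrt (2 * (a * |ε|)⁻¹) *
                  Real.sqrt ‖inner ℂ h
                    (Summit.AtomisticToContinuum.FouriersLaw.Theorems.MourreDissolution.mourreG U M ε z h)‖ +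
                2 * δ'⁻¹ * ‖h‖) := by
  intro K _ _ _ U Φ M a δ' ε z ha hMourre hδ hz hεz hloc hε
  exact ⟨fun h => apriori_mourreG U ha hMourre hδ hz hεz hloc hε h,
    fun hε0 => norm_mourreG_le_of_mourre U ha hMourre hδ hz hεz hloc hε hε0,
    fun hε0 h => norm_mourreG_apply_le_sqrt U ha hMourre hδ hz hεz hloc hε hε0 h,
    fun hε0 hloc' h => norm_adjoint_mourreG_apply_le_sqrt U ha hMourre hδ hz hεz hloc' hε hε0 h⟩

end Summit.AtomisticToContinuum.FouriersLaw.Theorems.MourreDissolution
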